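import Literature.AlgebraicGeometry.ShimuraVarieties.UnitaryAuxiliarySymplecticAdelic
import Mathlib.RingTheory.Trace.Basic
import HarnessLib

/-!
# The auxiliary symplectic form `ψ = Tr_{M/ℚ}(ᵗc(x)·diag(ξ₀, ξ H^j)·y)` is alternating and non-degenerate

Topic `AlgebraicGeometry/ShimuraVarieties`; namespace `Literature.AlgebraicGeometry.ShimuraVarieties.UnitaryCanonicalModel.Aux`.
Theorems only (no definition, no named fact).  Leaf Q6b-(i-a) of the I-1′ receptacle line (cell hodgecm-mathlib,
B-plan2 RECEPTACLE-PLAN §7): the input of the Frobenius normal form (★ `exists_frobeniusBasis_toMatrix`) that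
produces the symplectic frame of ★ `SymplecticFrame`.

For CM fields `L ⊆ M` (`j : L → M`), a hermitian `H ∈ M₃(L)` (`Hᴴ = H`) which is ANISOTROPIC, and purely imaginary
`ξ₀, ξ ∈ M^×` (`c ξ₀ = -ξ₀`, `c ξ = -ξ`), the Gram matrix `G = diag(ξ₀, ξ·H^j)` of ★ `auxGram` is skew-hermitian
(`Gᴴ = -G`, `conjTranspose_auxGram`) and invertible (`det_auxGram_ne_zero`); hence the `ℚ`-bilinear trace form
`ψ(x, y) = Tr_{M/ℚ}(ᵗc(x) G y)` of ★ `auxForm` is ALTERNATING (`auxForm_self_eq_zero`: `c(ᵗc(x)Gx) = -ᵗc(x)Gx` and the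
trace is `c`-invariant) and NON-DEGENERATE (`auxForm_nondegenerate`: the trace form of the separable `M/ℚ` is
non-degenerate, Mathlib `traceForm_nondegenerate`, and `G` is invertible).  This is the sentence «`ψ` is a
non-degenerate alternating form on `W₀ ⊕ V`» of [Deligne1979ShimuraVarieties, Prop. 2.3.10] / [Milne2005ShimuraVarieties, §8].

## References
* P. Deligne, *Variétés de Shimura*, Proc. Symp. Pure Math. 33 (1979), Prop. 2.3.10. [Deligne1979ShimuraVarieties]
* J. S. Milne, *Introduction to Shimura varieties* (2005), §8 p. 81. [Milne2005ShimuraVarieties]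
-/

noncomputable section

open Matrix NumberField IsDedekindDomain
open scoped TensorProduct

namespace Literature.AlgebraicGeometry.ShimuraVarieties.UnitaryCanonicalModel.Aux

open Literature.AlgebraicGeometry.ModuliOfAbelianVarieties
open Literature.NumberTheory.Automorphic Literature.NumberTheory.Automorphic.UnitaryGroup

variable {L : Type} [Field L] [NumberField L] [IsCMField L] {M : Type} [Field M] [NumberField M] [IsCMField M]
variable (j : L →+* M) (H : Matrix (Fin 3) (Fin 3) L) (ξ₀ ξ : M)

/-- `star` on a CM field is complex conjugation (Mathlib's `IsCMField.starRing`, definitional). [folklore] -/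
private theorem star_eq_complexConj (x : M) : star x = IsCMField.complexConj M x := rfl

/-- `(H^j)ᴴ = (Hᴴ)^j`: an embedding of CM fields commutes with complex conjugation entrywise.
[cite: Deligne1979ShimuraVarieties, 2.3.9 (PDF p. 32)] -/
theorem conjTranspose_map_ringHom : (H.map j)ᴴ = Hᴴ.map j := by
  ext a b
  simp only [conjTranspose_apply, map_apply, star_eq_complexConj]
  exact (ringHom_complexConj M j (H b a)).symm

/-- **`G = diag(ξ₀, ξ H^j)` is skew-hermitian**: `Gᴴ = -G` for `H` hermitian and `ξ₀, ξ` purely imaginary.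
[cite: Deligne1979ShimuraVarieties, Prop. 2.3.10 (PDF p. 32)] -/
theorem conjTranspose_auxGram (hH : Hᴴ = H) (hξ₀ : IsCMField.complexConj M ξ₀ = -ξ₀)
    (hξ : IsCMField.complexConj M ξ = -ξ) :
    (auxGram M j H ξ₀ ξ)ᴴ = -auxGram M j H ξ₀ ξ := by
  rw [auxGram, fromBlocks_conjTranspose, conjTranspose_smul, conjTranspose_smul, conjTranspose_one,
    conjTranspose_map_ringHom, hH, star_eq_complexConj, star_eq_complexConj, hξ₀, hξ, fromBlocks_neg]
  simp only [conjTranspose_zero, neg_zero, neg_smul]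

omit [NumberField L] [IsCMField L] in
/-- `ᵗc(x) G y`, conjugated, is `-ᵗc(y) G x` for a skew-hermitian `G`. [cite: Deligne1979ShimuraVarieties, Prop. 2.3.10 (PDF p. 32)] -/
theorem star_dotProduct_auxGram_mulVec (hG : (auxGram M j H ξ₀ ξ)ᴴ = -auxGram M j H ξ₀ ξ)
    (v w : (Fin 1 ⊕ Fin 3) → M) :
    star (star v ⬝ᵥ (auxGram M j H ξ₀ ξ *ᵥ w)) = -(star w ⬝ᵥ (auxGram M j H ξ₀ ξ *ᵥ v)) := by
  rw [star_dotProduct, star_mulVec, star_star, ← dotProduct_mulVec, hG, neg_mulVec, dotProduct_neg]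

/-- **`ψ` is alternating**: `ψ(x, x) = 0` (`x̄ᵗGx` is purely imaginary and the trace kills purely imaginary elements:
`Tr(c z) = Tr z`). [cite: Deligne1979ShimuraVarieties, Prop. 2.3.10 (PDF p. 32)] [cite: Milne2005ShimuraVarieties, §8 p. 81] -/
theorem auxForm_self_eq_zero (hH : Hᴴ = H) (hξ₀ : IsCMField.complexConj M ξ₀ = -ξ₀)
    (hξ : IsCMField.complexConj M ξ = -ξ) (v : (Fin 1 ⊕ Fin 3) → M) : auxForm M j H ξ₀ ξ v v = 0 := by
  have hG := conjTranspose_auxGram j H ξ₀ ξ hH hξ₀ hξ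
  set z : M := star v ⬝ᵥ (auxGram M j H ξ₀ ξ *ᵥ v) with hz
  have hψ : auxForm M j H ξ₀ ξ v v = Algebra.trace ℚ M z := by
    rw [auxForm_apply]
    rfl
  have hcz : IsCMField.complexConj M z = -z := by
    rw [← star_eq_complexConj, hz]
    exact star_dotProduct_auxGram_mulVec j H ξ₀ ξ hG v v
  have htr : Algebra.trace ℚ M z = Algebra.trace ℚ M (IsCMField.complexConj M z) :=
    (Algebra.trace_eq_of_algEquiv ((IsCMField.complexConj M).restrictScalars ℚ) z).symm
  rw [hcz, map_neg] at htr
  rw [hψ]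
  linarith

/-- **`H` anisotropic ⟹ `det H ≠ 0`.** [cite: Deligne1979ShimuraVarieties, Prop. 2.3.10 (PDF p. 32)] -/
theorem det_ne_zero_of_anisotropic (hH0 : ∀ v : Fin 3 → L, hermForm (cmConjRingHom L) H v v = 0 → v = 0) :
    H.det ≠ 0 := by
  intro hdet
  obtain ⟨v, hv, hHv⟩ := Matrix.exists_mulVec_eq_zero_iff.mpr hdet
  refine hv (hH0 v ?_)
  rw [hermForm, hHv, dotProduct_zero]

omit [NumberField M] [IsCMField M] in
/-- **`G = diag(ξ₀, ξ H^j)` is invertible** for `ξ₀ ξ ≠ 0` and `H` anisotropic: `det G = ξ₀ · ξ³ · j(det H) ≠ 0`.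
[cite: Deligne1979ShimuraVarieties, Prop. 2.3.10 (PDF p. 32)] -/
theorem det_auxGram_ne_zero (hξ₀ : ξ₀ ≠ 0) (hξ : ξ ≠ 0)
    (hH0 : ∀ v : Fin 3 → L, hermForm (cmConjRingHom L) H v v = 0 → v = 0) :
    (auxGram M j H ξ₀ ξ).det ≠ 0 := by
  have hdetH := det_ne_zero_of_anisotropic H hH0
  have hdetHj : (H.map j).det ≠ 0 := by
    rw [← RingHom.mapMatrix_apply, ← RingHom.map_det]
    exact (map_ne_zero j).mpr hdetH
  rw [auxGram, det_fromBlocks_zero₂₁, det_smul, det_one, det_smul]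
  simp only [Fintype.card_fin, mul_one, pow_one]
  exact mul_ne_zero hξ₀ (mul_ne_zero (pow_ne_zero _ hξ) hdetHj)

/-- **`ψ` is non-degenerate** (left and right separating): the trace form of `M/ℚ` is non-degenerate and `G` is
invertible. [cite: Deligne1979ShimuraVarieties, Prop. 2.3.10 (PDF p. 32)] [cite: Milne2005ShimuraVarieties, §8 p. 81] -/
theorem auxForm_nondegenerate (hξ₀ : ξ₀ ≠ 0) (hξ : ξ ≠ 0)
    (hH0 : ∀ v : Fin 3 → L, hermForm (cmConjRingHom L) H v v = 0 → v = 0) :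
    (auxForm M j H ξ₀ ξ).Nondegenerate := by
  classical
  have hdet := det_auxGram_ne_zero j H ξ₀ ξ hξ₀ hξ hH0
  have htr := traceForm_nondegenerate ℚ M
  -- `ψ x y = Tr ((star x ᵥ* G) ⬝ᵥ y)`
  have hψ : ∀ x y : (Fin 1 ⊕ Fin 3) → M,
      auxForm M j H ξ₀ ξ x y = Algebra.trace ℚ M ((star x ᵥ* auxGram M j H ξ₀ ξ) ⬝ᵥ y) := fun x y => by
    rw [auxForm_apply, dotProduct_mulVec]
    rfl
  refine ⟨fun x hx => ?_, fun y hy => ?_⟩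
  · -- left: `star x ᵥ* G = 0`
    have hr : star x ᵥ* auxGram M j H ξ₀ ξ = 0 := by
      funext k
      refine htr.1 _ fun m => ?_
      rw [Algebra.traceForm_apply]
      have := hx (Pi.single k m)
      rwa [hψ, dotProduct_single] at this
    have hx0 : star x = 0 := Matrix.eq_zero_of_vecMul_eq_zero hdet hr
    exact star_eq_zero.mp hx0
  · -- right: `G *ᵥ y = 0`
    have hr : auxGram M j H ξ₀ ξ *ᵥ y = 0 := by
      funext i
      refine htr.2 _ fun m => ?_
      rw [Algebra.traceForm_apply]
      have := hy (star (Pi.single i m))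
      rwa [hψ, star_star, ← dotProduct_mulVec, single_dotProduct] at this
    exact Matrix.eq_zero_of_mulVec_eq_zero hdet hr

end Literature.AlgebraicGeometry.ShimuraVarieties.UnitaryCanonicalModel.Aux

end
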